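import Mathlib
import Literature.Geometry.DiscreteGeometry.KissingPatterns
import Literature.Geometry.DiscreteGeometry.KissingRigidity

/-!
# Crux `DisclinationRation.FiveFoldRation` (stmt-AtomisticToContinuum-15799), line `Sketch` —
# helpers for stub `stub_dr5_dichotomy` (square/fold-back dichotomy), part 1: fcc and hcp

The square/fold-back dichotomy and the parallelogram law for induced `4`-cycles of the adjacency
`dist ≤ 26/25`, for the two scaled integer patterns `fccKissingPattern = fccInt/√2` (cuboctahedron)
and `hcpKissingPattern = hcpInt/√18` (anticuboctahedron).  The real thresholds are translated into
integer thresholds on `sqNormInt` (`dist² = sqNormInt/N`), the combinatorial cores are closed by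
`decide` on the integer models, and a generic transfer lemma (`dr5di_scaled_transfer`) carries them
back to `ℝ³` (additivity `intVec_add` is the landed one of `KissingRigidity`).  Helper prefix
`dr5di_`.  Terms are written out (no local notations).
-/

noncomputable section

namespace Summit.AtomisticToContinuum.Crystallization.Theorems

open Literature.Geometry.DiscreteGeometry

/-! ### Integer vectors and the scaling `v ↦ v/√N` -/

/-- `intVec (t + t' - y) = intVec t + intVec t' - intVec y`. -/
theorem dr5di_intVec_add_sub (t t' y : Fin 3 → ℤ) :
    intVec (t + t' - y) = intVec t + intVec t' - intVec y := by
  rw [← intVec_sub, intVec_add]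

/-- Distances in a scaled integer pattern: `dist (v/√N) (w/√N) = √|v - w|² / √N`. -/
theorem dr5di_dist_scaled (N : ℕ) (v w : Fin 3 → ℤ) :
    dist ((Real.sqrt N)⁻¹ • intVec v : EuclideanSpace ℝ (Fin 3)) ((Real.sqrt N)⁻¹ • intVec w) =
      (Real.sqrt N)⁻¹ * Real.sqrt (sqNormInt (v - w) : ℝ) := by
  rw [dist_eq_norm, ← smul_sub, intVec_sub, norm_smul, norm_inv,
    Real.norm_of_nonneg (Real.sqrt_nonneg _), norm_intVec]

/-- Norms in a scaled integer pattern: `‖u/√N‖ = √|u|² / √N`. -/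
theorem dr5di_norm_scaled (N : ℕ) (u : Fin 3 → ℤ) :
    ‖((Real.sqrt N)⁻¹ • intVec u : EuclideanSpace ℝ (Fin 3))‖ =
      (Real.sqrt N)⁻¹ * Real.sqrt (sqNormInt u : ℝ) := by
  rw [norm_smul, norm_inv, Real.norm_of_nonneg (Real.sqrt_nonneg _), norm_intVec]

/-- `√q/√N ≤ r ↔ q ≤ N·r²` for `r ≥ 0`, `N ≠ 0`. -/
theorem dr5di_scaled_le_iff {N : ℕ} (hN : N ≠ 0) (q : ℝ) {r : ℝ} (hr : 0 ≤ r) :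
    (Real.sqrt N)⁻¹ * Real.sqrt q ≤ r ↔ q ≤ N * r ^ 2 := by
  have hpos : (0 : ℝ) < Real.sqrt N := Real.sqrt_pos.2 (by exact_mod_cast Nat.pos_of_ne_zero hN)
  rw [inv_mul_le_iff₀ hpos, Real.sqrt_le_left (by positivity), mul_pow,
    Real.sq_sqrt (Nat.cast_nonneg N)]

/-- `r < √q/√N ↔ N·r² < q` for `r ≥ 0`, `N ≠ 0`. -/
theorem dr5di_lt_scaled_iff {N : ℕ} (hN : N ≠ 0) (q : ℝ) {r : ℝ} (hr : 0 ≤ r) :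
    r < (Real.sqrt N)⁻¹ * Real.sqrt q ↔ N * r ^ 2 < q := by
  rw [← not_le, dr5di_scaled_le_iff hN q hr, not_le]

/-! ### The generic transfer lemma -/

/-- **Transfer.** For a scaled integer pattern `S/√N`: if the integer model satisfies the
square/fold-back dichotomy and the parallelogram law with integer thresholds `a` (adjacent:
`|v-w|² ≤ a`), `b` (non-adjacent: `b ≤ |v-w|²`), `c` (diagonal bound) and `d` (fold-back bound)
compatible with the real thresholds `26/25`, `3/2`, `61/100`, then `S/√N` satisfies both clauses of
the dichotomy. -/
theorem dr5di_scaled_transfer {S : Finset (Fin 3 → ℤ)} {N : ℕ} (hN : N ≠ 0) {a b c d : ℤ}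
    (ha : (676 : ℝ) * N < 625 * ((a : ℝ) + 1)) (hb : (625 : ℝ) * ((b : ℝ) - 1) ≤ 676 * N)
    (hc : (4 : ℝ) * c ≤ 9 * N) (hd : (10000 : ℝ) * d ≤ 3721 * N)
    (h1 : ∀ y ∈ S, ∀ t ∈ S, sqNormInt (y - t) ≤ a → ∀ t' ∈ S, sqNormInt (y - t') ≤ a → t ≠ t' →
      b ≤ sqNormInt (t - t') →
        (t + t' - y ∈ S ∧ sqNormInt (t - t') ≤ c) ∨ sqNormInt (t + t' - y) ≤ d)
    (h2 : ∀ t₁ ∈ S, ∀ t₂ ∈ S, sqNormInt (t₁ - t₂) ≤ a → ∀ t₃ ∈ S, sqNormInt (t₂ - t₃) ≤ a →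
      b ≤ sqNormInt (t₁ - t₃) → ∀ t₄ ∈ S, sqNormInt (t₃ - t₄) ≤ a → sqNormInt (t₄ - t₁) ≤ a →
        b ≤ sqNormInt (t₂ - t₄) → t₁ + t₃ = t₂ + t₄) :
    (∀ Y ∈ (scaledPattern S N : Set (EuclideanSpace ℝ (Fin 3))),
      ∀ T ∈ (scaledPattern S N : Set (EuclideanSpace ℝ (Fin 3))),
      ∀ T' ∈ (scaledPattern S N : Set (EuclideanSpace ℝ (Fin 3))),
      dist Y T ≤ 26 / 25 → dist Y T' ≤ 26 / 25 → T ≠ T' → 26 / 25 < dist T T' →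
        ((T + T' - Y ∈ (scaledPattern S N : Set (EuclideanSpace ℝ (Fin 3))) ∧ dist T T' ≤ 3 / 2) ∨
          ‖T + T' - Y‖ ≤ 61 / 100)) ∧
    (∀ T₁ ∈ (scaledPattern S N : Set (EuclideanSpace ℝ (Fin 3))),
      ∀ T₂ ∈ (scaledPattern S N : Set (EuclideanSpace ℝ (Fin 3))),
      ∀ T₃ ∈ (scaledPattern S N : Set (EuclideanSpace ℝ (Fin 3))),
      ∀ T₄ ∈ (scaledPattern S N : Set (EuclideanSpace ℝ (Fin 3))),
      dist T₁ T₂ ≤ 26 / 25 → dist T₂ T₃ ≤ 26 / 25 → dist T₃ T₄ ≤ 26 / 25 → dist T₄ T₁ ≤ 26 / 25 →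
        26 / 25 < dist T₁ T₃ → 26 / 25 < dist T₂ T₄ → T₁ + T₃ = T₂ + T₄) := by
  -- real ↔ integer threshold conversions
  have hA : ∀ v w : Fin 3 → ℤ, dist ((Real.sqrt N)⁻¹ • intVec v : EuclideanSpace ℝ (Fin 3))
      ((Real.sqrt N)⁻¹ • intVec w) ≤ 26 / 25 → sqNormInt (v - w) ≤ a := by
    intro v w h
    rw [dr5di_dist_scaled, dr5di_scaled_le_iff hN _ (by norm_num)] at h
    have h' : (sqNormInt (v - w) : ℝ) < a + 1 := by nlinarith
    exact Int.lt_add_one_iff.1 (by exact_mod_cast h')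
  have hB : ∀ v w : Fin 3 → ℤ,
      26 / 25 < dist ((Real.sqrt N)⁻¹ • intVec v : EuclideanSpace ℝ (Fin 3))
        ((Real.sqrt N)⁻¹ • intVec w) → b ≤ sqNormInt (v - w) := by
    intro v w h
    rw [dr5di_dist_scaled, dr5di_lt_scaled_iff hN _ (by norm_num)] at h
    have h' : (b : ℝ) - 1 < sqNormInt (v - w) := by nlinarith
    have h'' : b - 1 < sqNormInt (v - w) := by exact_mod_cast h'
    omega
  refine ⟨?_, ?_⟩
  · intro Y hY T hT T' hT' hYT hYT' hne hTT'
    rw [Finset.mem_coe] at hY hT hT'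
    obtain ⟨y, hy, rfl⟩ := Finset.mem_image.1 hY
    obtain ⟨t, ht, rfl⟩ := Finset.mem_image.1 hT
    obtain ⟨t', ht', rfl⟩ := Finset.mem_image.1 hT'
    have hne' : t ≠ t' := fun h => hne (by rw [h])
    have hX : ((Real.sqrt N)⁻¹ • intVec t + (Real.sqrt N)⁻¹ • intVec t' -
        (Real.sqrt N)⁻¹ • intVec y : EuclideanSpace ℝ (Fin 3)) =
        (Real.sqrt N)⁻¹ • intVec (t + t' - y) := by
      rw [dr5di_intVec_add_sub, smul_sub, smul_add]
    rcases h1 y hy t ht (hA _ _ hYT) t' ht' (hA _ _ hYT') hne' (hB _ _ hTT') with ⟨hmem, hle⟩ | hle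
    · refine Or.inl ⟨?_, ?_⟩
      · rw [hX, Finset.mem_coe]
        exact Finset.mem_image_of_mem _ hmem
      · rw [dr5di_dist_scaled, dr5di_scaled_le_iff hN _ (by norm_num)]
        have : (sqNormInt (t - t') : ℝ) ≤ c := by exact_mod_cast hle
        nlinarith
    · refine Or.inr ?_
      rw [hX, dr5di_norm_scaled, dr5di_scaled_le_iff hN _ (by norm_num)]
      have : (sqNormInt (t + t' - y) : ℝ) ≤ d := by exact_mod_cast hle
      nlinarith
  · intro T₁ hT₁ T₂ hT₂ T₃ hT₃ T₄ hT₄ h12 h23 h34 h41 h13 h24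
    rw [Finset.mem_coe] at hT₁ hT₂ hT₃ hT₄
    obtain ⟨t₁, ht₁, rfl⟩ := Finset.mem_image.1 hT₁
    obtain ⟨t₂, ht₂, rfl⟩ := Finset.mem_image.1 hT₂
    obtain ⟨t₃, ht₃, rfl⟩ := Finset.mem_image.1 hT₃
    obtain ⟨t₄, ht₄, rfl⟩ := Finset.mem_image.1 hT₄
    have key := h2 t₁ ht₁ t₂ ht₂ (hA _ _ h12) t₃ ht₃ (hA _ _ h23) (hB _ _ h13) t₄ ht₄ (hA _ _ h34)
      (hA _ _ h41) (hB _ _ h24)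
    rw [← smul_add, ← smul_add, ← intVec_add, ← intVec_add, key]

/-! ### The combinatorial cores, by `decide` -/

/-- fcc integer model (`N = 2`; adjacent `↔ |v-w|² ≤ 2`, non-adjacent `↔ 3 ≤ |v-w|²`): the
square/fold-back dichotomy (the fold-back vector is `0`: opposite corners of the vertex figure). -/
theorem dr5di_fccInt_dicho :
    ∀ y ∈ fccInt, ∀ t ∈ fccInt, sqNormInt (y - t) ≤ 2 → ∀ t' ∈ fccInt, sqNormInt (y - t') ≤ 2 →
      t ≠ t' → 3 ≤ sqNormInt (t - t') →
        (t + t' - y ∈ fccInt ∧ sqNormInt (t - t') ≤ 4) ∨ sqNormInt (t + t' - y) ≤ 0 := by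
  decide

/-- fcc integer model: induced `4`-cycles are parallelograms (the six square faces). -/
theorem dr5di_fccInt_cycle :
    ∀ t₁ ∈ fccInt, ∀ t₂ ∈ fccInt, sqNormInt (t₁ - t₂) ≤ 2 → ∀ t₃ ∈ fccInt,
      sqNormInt (t₂ - t₃) ≤ 2 → 3 ≤ sqNormInt (t₁ - t₃) → ∀ t₄ ∈ fccInt,
        sqNormInt (t₃ - t₄) ≤ 2 → sqNormInt (t₄ - t₁) ≤ 2 → 3 ≤ sqNormInt (t₂ - t₄) →
          t₁ + t₃ = t₂ + t₄ := by
  decide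

/-- hcp integer model (`N = 18`; adjacent `↔ |v-w|² ≤ 19`, non-adjacent `↔ 20 ≤ |v-w|²`,
diagonal bound `|v-w|² ≤ 40`, fold-back bound `|·|² ≤ 6`): the square/fold-back dichotomy. -/
theorem dr5di_hcpInt_dicho :
    ∀ y ∈ hcpInt, ∀ t ∈ hcpInt, sqNormInt (y - t) ≤ 19 → ∀ t' ∈ hcpInt, sqNormInt (y - t') ≤ 19 →
      t ≠ t' → 20 ≤ sqNormInt (t - t') →
        (t + t' - y ∈ hcpInt ∧ sqNormInt (t - t') ≤ 40) ∨ sqNormInt (t + t' - y) ≤ 6 := by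
  decide

/-- hcp integer model: induced `4`-cycles are parallelograms (the six square faces). -/
theorem dr5di_hcpInt_cycle :
    ∀ t₁ ∈ hcpInt, ∀ t₂ ∈ hcpInt, sqNormInt (t₁ - t₂) ≤ 19 → ∀ t₃ ∈ hcpInt,
      sqNormInt (t₂ - t₃) ≤ 19 → 20 ≤ sqNormInt (t₁ - t₃) → ∀ t₄ ∈ hcpInt,
        sqNormInt (t₃ - t₄) ≤ 19 → sqNormInt (t₄ - t₁) ≤ 19 → 20 ≤ sqNormInt (t₂ - t₄) →
          t₁ + t₃ = t₂ + t₄ := by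
  decide

/-! ### The dichotomy for the fcc and hcp patterns -/

/-- **Square/fold-back dichotomy and parallelogram law for the fcc pattern** (cuboctahedron). -/
theorem dr5di_fcc :
    (∀ Y ∈ (fccKissingPattern : Set (EuclideanSpace ℝ (Fin 3))),
      ∀ T ∈ (fccKissingPattern : Set (EuclideanSpace ℝ (Fin 3))),
      ∀ T' ∈ (fccKissingPattern : Set (EuclideanSpace ℝ (Fin 3))),
      dist Y T ≤ 26 / 25 → dist Y T' ≤ 26 / 25 → T ≠ T' → 26 / 25 < dist T T' →
        ((T + T' - Y ∈ (fccKissingPattern : Set (EuclideanSpace ℝ (Fin 3))) ∧ dist T T' ≤ 3 / 2) ∨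
          ‖T + T' - Y‖ ≤ 61 / 100)) ∧
    (∀ T₁ ∈ (fccKissingPattern : Set (EuclideanSpace ℝ (Fin 3))),
      ∀ T₂ ∈ (fccKissingPattern : Set (EuclideanSpace ℝ (Fin 3))),
      ∀ T₃ ∈ (fccKissingPattern : Set (EuclideanSpace ℝ (Fin 3))),
      ∀ T₄ ∈ (fccKissingPattern : Set (EuclideanSpace ℝ (Fin 3))),
      dist T₁ T₂ ≤ 26 / 25 → dist T₂ T₃ ≤ 26 / 25 → dist T₃ T₄ ≤ 26 / 25 → dist T₄ T₁ ≤ 26 / 25 →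
        26 / 25 < dist T₁ T₃ → 26 / 25 < dist T₂ T₄ → T₁ + T₃ = T₂ + T₄) :=
  dr5di_scaled_transfer (S := fccInt) (N := 2) two_ne_zero (a := 2) (b := 3) (c := 4) (d := 0)
    (by norm_num) (by norm_num) (by norm_num) (by norm_num) dr5di_fccInt_dicho dr5di_fccInt_cycle

/-- **Square/fold-back dichotomy and parallelogram law for the hcp pattern** (anticuboctahedron;
the fold-back values are `0` and `1/√3`). -/
theorem dr5di_hcp :
    (∀ Y ∈ (hcpKissingPattern : Set (EuclideanSpace ℝ (Fin 3))),
      ∀ T ∈ (hcpKissingPattern : Set (EuclideanSpace ℝ (Fin 3))),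
      ∀ T' ∈ (hcpKissingPattern : Set (EuclideanSpace ℝ (Fin 3))),
      dist Y T ≤ 26 / 25 → dist Y T' ≤ 26 / 25 → T ≠ T' → 26 / 25 < dist T T' →
        ((T + T' - Y ∈ (hcpKissingPattern : Set (EuclideanSpace ℝ (Fin 3))) ∧ dist T T' ≤ 3 / 2) ∨
          ‖T + T' - Y‖ ≤ 61 / 100)) ∧
    (∀ T₁ ∈ (hcpKissingPattern : Set (EuclideanSpace ℝ (Fin 3))),
      ∀ T₂ ∈ (hcpKissingPattern : Set (EuclideanSpace ℝ (Fin 3))),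
      ∀ T₃ ∈ (hcpKissingPattern : Set (EuclideanSpace ℝ (Fin 3))),
      ∀ T₄ ∈ (hcpKissingPattern : Set (EuclideanSpace ℝ (Fin 3))),
      dist T₁ T₂ ≤ 26 / 25 → dist T₂ T₃ ≤ 26 / 25 → dist T₃ T₄ ≤ 26 / 25 → dist T₄ T₁ ≤ 26 / 25 →
        26 / 25 < dist T₁ T₃ → 26 / 25 < dist T₂ T₄ → T₁ + T₃ = T₂ + T₄) :=
  dr5di_scaled_transfer (S := hcpInt) (N := 18) (by norm_num) (a := 19) (b := 20) (c := 40)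
    (d := 6) (by norm_num) (by norm_num) (by norm_num) (by norm_num) dr5di_hcpInt_dicho
    dr5di_hcpInt_cycle

end Summit.AtomisticToContinuum.Crystallization.Theorems

end
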